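import Summits.QuantumFields.YangMills.Theorems.AllWindowsColdBoxBoxHighWindowsSU22LineDefs

/-!
# TASK T-S5/U5.3 «orbit localisation» — the deterministic half of step (1) of the comparison stubs S5 (LINE-19 ⟨24004⟩/⟨24335⟩,
# `stub_landauSecondOrder`) and U5 (LINE-20 ⟨24336⟩, `stub_landauThirdOrder`): typed obligation Props, planner ym-idea-2 g17.

After the smeared Faddeev–Popov identity (T-S5.1, `SmearedFPIdentity`) the weight `h` is localised on configurations whose box links are
all within defect-radius `r` of the identity.  The Laplace asymptotics of the orbit average `N_h(U) = ∫ h(U^g) dg` (T-S5.4) needs to know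
WHERE on the orbit such configurations can sit.  The answer is elementary and needs no smallness hypothesis at all:

*if two INTERIOR gauge transformations `g, g'` both put `U` in the defect ball of radius `r` on every box link, then the relative
transformation `h = g'·g⁻¹` satisfies `‖h_x − h_y‖_F ≤ 2√2·r` across every box link (T-S5.3a) and hence, telescoping along a straight
lattice path of length `< 2H` to the wall where `h = 1`, `½‖h_x − 1‖_F² ≤ 16 r² H²` at every site (T-S5.3).*

(`2 − Re tr A = ½‖A − 1‖_F²` on `SU(2)`; equivalently, writing `SU(2)` as the unit quaternions `S³ ⊂ ℝ⁴`, `2 − Re tr(A B⁻¹) = |a − b|²`, a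
squared Euclidean distance — so the only analysis is the triangle inequality in `ℝ⁴` / Frobenius norm.)  Combined with the Landau
representative (✓`stub_landauRepresentative`, S4b; ✓`stub_landauRepresentativeStrong`, U2: radius `r² = C H²(1+log H)² s²`) this pins
every near-identity representative of the orbit to the `O(r·H)`-neighbourhood of the Landau representative's gauge, which is
`o(1)` exactly when `s·H²·(1+log H) → 0` — automatic in every window of the route (`s = β^{-1/2+κ}`, `H = β^θ`, `θ < 1/4`).

T-S5.3a `GaugeLinkStep` (S): the one-link estimate.
T-S5.3  `OrbitLocalisation` (S–M): the telescoped estimate at every site.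

HONEST LABEL: definitions/Props only; nothing is proved here; S5, U5, ⟨24004⟩ ⟨24335⟩ ⟨24336⟩ remain OPEN; the Yang–Mills mass gap is
NOT proved by this file.
-/

set_option autoImplicit false

noncomputable section

open Matrix
open Literature.MathematicalPhysics.QuantumFieldTheory
open Literature.MathematicalPhysics.QuantumFieldTheory.AxialGauge
open Literature.MathematicalPhysics.QuantumLattice

namespace Summit.QuantumFields.YangMills.Theorems.AllWindowsColdBoxBoxHighLine

/-- Gauge distance at a site, in the `linkDefect` normalisation: `2 − Re tr (g' x · (g x)⁻¹) = ½‖g'_x − g_x‖_F²`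
(`= |a' − a|²` for the unit quaternions `a, a'` of `g x, g' x`). -/
def gaugeDist (g g' : Literature.Probability.LatticeModels.Site 4 → SU2) (x : Literature.Probability.LatticeModels.Site 4) : ℝ :=
  2 - (((g' x * (g x)⁻¹ : SU2) : Matrix (Fin 2) (Fin 2) ℂ).trace).re

/-- T-S5.3a **(one-link step; S)**: if `U^g` and `U^{g'}` both have defect `≤ r²` on the link `e = (x, μ)`, then the relative gauge
`h = g'·g⁻¹` moves by at most `2√2·r` in Frobenius norm across `e`, i.e. `½‖h_x − h_{x+μ}‖_F² ≤ 4 r²`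
(`h_x h_{x+μ}⁻¹ − 1 = (h_x V_e h_{x+μ}⁻¹ − 1) + h_x (1 − V_e) h_{x+μ}⁻¹` with `V = U^g`, `V^h = U^{g'}`, unitary invariance of `‖·‖_F`). -/
def GaugeLinkStep : Prop :=
  ∀ r : ℝ, 0 ≤ r → ∀ U : LGConfig 4 SU2, ∀ g g' : Literature.Probability.LatticeModels.Site 4 → SU2,
    ∀ e : Literature.MathematicalPhysics.QuantumLattice.ZdEdge 4,
      linkDefect (gaugeTransformZd g U) e ≤ r ^ 2 → linkDefect (gaugeTransformZd g' U) e ≤ r ^ 2 →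
        2 - ((((g' e.1 * (g e.1)⁻¹) * (g' (e.1 + Pi.single e.2 1) * (g (e.1 + Pi.single e.2 1))⁻¹)⁻¹ : SU2) :
              Matrix (Fin 2) (Fin 2) ℂ).trace).re ≤ 4 * r ^ 2

/-- T-S5.3 **(orbit localisation; S–M)**: two INTERIOR gauge transformations that both put `U` in the defect ball of radius `r` on every
box link differ by at most `16 r² H²` in gauge distance at every site (telescoping T-S5.3a along the straight path
`(0, x₁, x₂, x₃) → x` of `< 2H` box links, at whose start `g = g' = 1`).  No smallness hypothesis is needed. -/
def OrbitLocalisation : Prop :=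
  ∀ H : ℕ, ∀ r : ℝ, 0 ≤ r → ∀ U : LGConfig 4 SU2, ∀ g g' : Literature.Probability.LatticeModels.Site 4 → SU2,
    IsInteriorGauge H g → IsInteriorGauge H g' →
    (∀ e ∈ boxEdges 4 (2 * H + 1), linkDefect (gaugeTransformZd g U) e ≤ r ^ 2) →
    (∀ e ∈ boxEdges 4 (2 * H + 1), linkDefect (gaugeTransformZd g' U) e ≤ r ^ 2) →
      ∀ x, gaugeDist g g' x ≤ 16 * r ^ 2 * (H : ℝ) ^ 2

/-- Sanity (definitional): off the interior both transformations are `1`, so the gauge distance vanishes there. -/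
theorem gaugeDist_of_not_mem (H : ℕ) (g g' : Literature.Probability.LatticeModels.Site 4 → SU2)
    (hg : IsInteriorGauge H g) (hg' : IsInteriorGauge H g') (x : Literature.Probability.LatticeModels.Site 4)
    (hx : x ∉ interiorSites H) : gaugeDist g g' x = 0 := by
  simp [gaugeDist, hg x hx, hg' x hx, Matrix.trace_one]

end Summit.QuantumFields.YangMills.Theorems.AllWindowsColdBoxBoxHighLine

end
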